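import Literature.NumberTheory.EllipticCurves.GaloisAction
import HarnessLib

/-!
# Runbook sanity lemmas — discrete Galois modules (REVIEW-RUNBOOK card `discreteContRep` of `pub-bsdpct`)

Mechanical companions of the definition card `Literature.NumberTheory.EllipticCurves.discreteContRep`
of `REVIEW-RUNBOOK.md` for `heightDensityGE_rankLeOne_and_fullBSDOffSgoPrime_cRank_of_sieve` (cell
`pub-bsdpct`), generated by the ops-runbook seat (review-runbook/4): (a) EVALUATION — the continuous
`ℤ`-linear representation built from a discrete `G`-module is, pointwise, the given action `g • m`, both as a
continuous representation and through Mathlib's `ContRepresentation.toRepresentation`.  So the Galois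
cohomology groups formed from `discreteContRep` (`discreteH1`, `galH1`, Ш) are those of the intended module.

Nothing here is used by the theorem under review; these are reader-facing checks.
-/

namespace Summit.BirchSwinnertonDyer.BSDPercentage.Runbook

open Literature.NumberTheory.EllipticCurves

universe u

variable (G : Type u) [Group G]
variable (M : Type u) [AddCommGroup M] [DistribMulAction G M] [TopologicalSpace M] [DiscreteTopology M]

/-- (a) EVALUATION: `(discreteContRep G M) g m = g • m` — the packaged continuous representation is the
given action of `G` on the discrete module `M`. -/
theorem discreteContRep_apply (g : G) (m : M) : discreteContRep G M g m = g • m := rfl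

/-- (a) EVALUATION through Mathlib's forgetful map: the underlying `Representation ℤ G M` of
`discreteContRep G M` is the action `g • m` as well. -/
theorem discreteContRep_toRepresentation_apply (g : G) (m : M) :
    ContRepresentation.toRepresentation ℤ G M (discreteContRep G M) g m = g • m := rfl

end Summit.BirchSwinnertonDyer.BSDPercentage.Runbook
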